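import Summits.ValiantsHypothesis.ValiantsHypothesis.Theorems.KPlusLogSqLawStaticPathOpt

/-!
# Route «KPlusLogSqLaw» — parametric max-weight independent set on a path: chains of unique optima of length `n` exist for every `n`

HONEST FRAMING.  Helper toward the crux `WeakLifting` (item `stmt-ValiantsHypothesis-19561`, route `KPlusLogSqLaw`, cell `pub-symmetroid`,
seat val-sym-lift-p4 g8, 2026-08-27) on the line of its witness-plan stub `stub_tridiagonalSectorB` (tropical twin of the STATIC tridiagonal
sector = parametric maximum-weight independent set on a path).  The kernel CEILING for chains of unique optima of a block of `n` items is
`66 · n · (⌊log₂ n⌋ + 2)` (val-sym-lift-p3 g6, `StaticPathFold.chain_le`); this file gives the matching-order FLOOR in the same currency: for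
every `n` an explicit block of `n` items with a chain of `n + 1` unique optima at strictly increasing parameters, consecutive ones distinct
(`exists_chain_length`).  The family is the trivial «sign-certified» one (odd items die one by one, then even items are born one by one; at each
sample parameter the optimal set is exactly the set of items of positive weight, `unique_of_signs`), so its rate is 1 event per item; the
located floor of record is `11n/6 - 10` (val-sym-lift-p4 g7, family F6, `HOME/val-sym-lift-p4/LINEAR-LAW.md` §4.5, two seats) and the
conjectured truth `2n - 4` (exhaustive for `n ≤ 7`); neither is claimed here.  Statements about a path DP; nothing here asserts anything about
`WeakLifting`, `TropicalB`, `KPlusLogSqLaw`, the stub in its window, `MatrixDescartes` (stmt-ValiantsHypothesis-18050) or `VP ≠ VNP`.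
-/

set_option linter.dupNamespace false
set_option autoImplicit false

namespace Summit.ValiantsHypothesis.ValiantsHypothesis.Theorems.KPlusLogSqLaw

open Finset Classical

namespace StaticPathFold

noncomputable section

variable (w₁ w₀ : ℕ → ℝ)

/-- **sign certificate of unique optimality**: if a set `M` consists of items of positive weight and every other item of the block has
negative weight, then every independent subset of the block other than `M` weighs strictly less than `M`. [folklore] -/
theorem unique_of_signs {i n : ℕ} {θ : ℝ} {M : Finset ℕ}
    (hpos : ∀ t ∈ M, 0 < W w₁ w₀ t θ) (hneg : ∀ t ∈ Ioc i (i + n), t ∉ M → W w₁ w₀ t θ < 0) :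
    ∀ S ∈ indepSets i n, S ≠ M → ∑ t ∈ S, W w₁ w₀ t θ < ∑ t ∈ M, W w₁ w₀ t θ := by
  intro S hS hSM
  rcases mem_indepSets.mp hS with ⟨hS1, _⟩
  -- split `S` into its part inside `M` and its part outside
  rw [← sum_filter_add_sum_filter_not S (fun t => t ∈ M)]
  have hsubM : S.filter (fun t => t ∈ M) ⊆ M := fun t ht => (mem_filter.mp ht).2
  have h1 : ∑ t ∈ S.filter (fun t => t ∈ M), W w₁ w₀ t θ ≤ ∑ t ∈ M, W w₁ w₀ t θ :=
    sum_le_sum_of_subset_of_nonneg hsubM (fun t ht _ => (hpos t ht).le)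
  have hout : ∀ t ∈ S.filter (fun t => t ∉ M), W w₁ w₀ t θ < 0 :=
    fun t ht => hneg t (hS1 (mem_filter.mp ht).1) (mem_filter.mp ht).2
  have h2 : ∑ t ∈ S.filter (fun t => t ∉ M), W w₁ w₀ t θ ≤ 0 := sum_nonpos fun t ht => (hout t ht).le
  -- one of the two inequalities is strict since `S ≠ M`
  by_cases hsub : M ⊆ S
  · -- then some item of `S` lies outside `M`
    obtain ⟨t, htS, htM⟩ := not_subset.mp (fun h => hSM (Subset.antisymm h hsub))
    have hne : (S.filter (fun t => t ∉ M)).Nonempty := ⟨t, mem_filter.mpr ⟨htS, htM⟩⟩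
    have h2' : ∑ t ∈ S.filter (fun t => t ∉ M), W w₁ w₀ t θ < 0 := sum_neg hout hne
    linarith
  · -- some `t ∈ M` is missing from `S`
    obtain ⟨t, htM, htS⟩ := not_subset.mp hsub
    have h1' : ∑ t ∈ S.filter (fun t => t ∈ M), W w₁ w₀ t θ < ∑ t ∈ M, W w₁ w₀ t θ :=
      sum_lt_sum_of_subset hsubM htM (fun h => htS (mem_filter.mp h).1) (hpos t htM)
        (fun u hu _ => (hpos u hu).le)
    linarith

/-- **FLOOR: chains of unique optima of length `n` for every `n`.**  Items `t = 1, …, n` with weights `W t θ = t - θ` (odd `t`) and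
`W t θ = θ - (n + t)` (even `t`); parameters `θ_k = 2k` for `k ≤ ⌈n/2⌉` (the odd items die one by one, then none is alive) and
`θ_k = n + 2(k - ⌈n/2⌉) + 1` beyond (the even items are born one by one); at each `θ_k` the unique optimum is the set of items of positive weight,
and consecutive optima differ. [folklore] -/
theorem exists_chain_length (n : ℕ) :
    ∃ (w₁ w₀ : ℕ → ℝ) (θs : Fin (n + 1) → ℝ) (Ms : Fin (n + 1) → Finset ℕ),
      StrictMono θs ∧ (∀ k, Ms k ∈ indepSets 0 n) ∧
      (∀ k, ∀ S ∈ indepSets 0 n, S ≠ Ms k → ∑ t ∈ S, W w₁ w₀ t (θs k) < ∑ t ∈ Ms k, W w₁ w₀ t (θs k)) ∧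
      (∀ e : Fin n, Ms e.castSucc ≠ Ms e.succ) := by
  -- the family
  set o := (n + 1) / 2 with ho
  set w₁ : ℕ → ℝ := fun t => if Even t then 1 else -1 with hw₁
  set w₀ : ℕ → ℝ := fun t => if Even t then -((n : ℝ) + t) else (t : ℝ) with hw₀
  set τ : ℕ → ℕ := fun k => if k ≤ o then 2 * k else n + 2 * (k - o) + 1 with hτ
  set θs : Fin (n + 1) → ℝ := fun k => ((τ k : ℕ) : ℝ) with hθs
  set Ms : Fin (n + 1) → Finset ℕ := fun k => (Ioc 0 (0 + n)).filter (fun t => 0 < W w₁ w₀ t (θs k)) with hMs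
  -- the weights in closed form
  have hW : ∀ t (θ : ℝ), W w₁ w₀ t θ = if Even t then θ - ((n : ℝ) + t) else (t : ℝ) - θ := by
    intro t θ
    simp only [W, hw₁, hw₀]
    split_ifs <;> ring
  -- sign analysis at the sample parameters
  have hτmono : StrictMono τ := by
    intro k k' hkk'
    simp only [hτ]
    split_ifs <;> omega
  have hsign : ∀ (k : Fin (n + 1)) (t : ℕ), 1 ≤ t → t ≤ n →
      (0 < W w₁ w₀ t (θs k) ↔ ((k : ℕ) ≤ o ∧ Odd t ∧ 2 * (k : ℕ) + 1 ≤ t) ∨ (o < (k : ℕ) ∧ Even t ∧ t ≤ 2 * ((k : ℕ) - o))) ∧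
      W w₁ w₀ t (θs k) ≠ 0 := by
    intro k t ht1 htn
    have hk : (k : ℕ) ≤ n := Nat.lt_succ_iff.mp k.isLt
    rw [hW]
    simp only [hθs, hτ]
    by_cases hko : (k : ℕ) ≤ o
    · rw [if_pos hko]
      by_cases he : Even t
      · rw [if_pos he]
        have hodd : ¬ Odd t := fun h => (Nat.not_even_iff_odd.mpr h) he
        have : (2 * (k : ℕ) : ℝ) - ((n : ℝ) + t) < 0 := by
          have h1 : 2 * (k : ℕ) ≤ n + 1 := by omega
          have h2 : ((2 * (k : ℕ) : ℕ) : ℝ) ≤ (n : ℝ) + 1 := by exact_mod_cast h1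
          push_cast at h2
          have h3 : (1 : ℝ) ≤ t := by exact_mod_cast ht1
          have h4 : (2 : ℝ) ≤ t := by
            obtain ⟨r, hr⟩ := he
            have : 2 ≤ t := by omega
            exact_mod_cast this
          linarith
        push_cast
        refine ⟨⟨fun h => absurd h (not_lt.mpr this.le), ?_⟩, this.ne⟩
        rintro (⟨_, ho', _⟩ | ⟨ho', _, _⟩)
        · exact absurd ho' hodd
        · exact absurd hko (not_le.mpr ho')
      · rw [if_neg he]
        have hodd : Odd t := Nat.not_even_iff_odd.mp he
        push_cast
        constructor
        · constructor
          · intro h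
            left
            refine ⟨hko, hodd, ?_⟩
            have h1 : (2 * (k : ℕ) : ℝ) < t := by linarith
            have h2 : 2 * (k : ℕ) < t := by exact_mod_cast h1
            -- `t` odd and `> 2k` gives `≥ 2k + 1`
            omega
          · rintro (⟨_, _, h⟩ | ⟨ho', _, _⟩)
            · have h2 : ((2 * (k : ℕ) + 1 : ℕ) : ℝ) ≤ t := by exact_mod_cast h
              push_cast at h2
              linarith
            · exact absurd hko (not_le.mpr ho')
        · intro h
          have h1 : (t : ℝ) = 2 * (k : ℕ) := by linarith
          have h2 : t = 2 * (k : ℕ) := by exact_mod_cast h1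
          obtain ⟨r, hr⟩ := hodd
          omega
    · rw [if_neg hko]
      have hko' : o < (k : ℕ) := not_le.mp hko
      by_cases he : Even t
      · rw [if_pos he]
        push_cast
        constructor
        · constructor
          · intro h
            right
            refine ⟨hko', he, ?_⟩
            have h1 : (t : ℝ) < 2 * (((k : ℕ) - o : ℕ) : ℝ) + 1 := by linarith
            have h2 : t < 2 * ((k : ℕ) - o) + 1 := by exact_mod_cast h1
            omega
          · rintro (⟨ho', _, _⟩ | ⟨_, _, h⟩)
            · exact absurd ho' hko
            · have h2 : (t : ℝ) ≤ ((2 * ((k : ℕ) - o) : ℕ) : ℝ) := by exact_mod_cast h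
              push_cast at h2
              linarith
        · intro h
          have h1 : (t : ℝ) = 2 * (((k : ℕ) - o : ℕ) : ℝ) + 1 := by linarith
          have h2 : t = 2 * ((k : ℕ) - o) + 1 := by exact_mod_cast h1
          obtain ⟨r, hr⟩ := he
          omega
      · rw [if_neg he]
        have hodd : Odd t := Nat.not_even_iff_odd.mp he
        have hne : ¬ Even t := he
        have : (t : ℝ) - ((n : ℝ) + 2 * (((k : ℕ) - o : ℕ) : ℝ) + 1) < 0 := by
          have h3 : (t : ℝ) ≤ n := by exact_mod_cast htn
          have h4 : (0 : ℝ) ≤ (((k : ℕ) - o : ℕ) : ℝ) := Nat.cast_nonneg _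
          linarith
        push_cast
        refine ⟨⟨fun h => absurd h (not_lt.mpr this.le), ?_⟩, this.ne⟩
        rintro (⟨ho', _, _⟩ | ⟨_, he', _⟩)
        · exact absurd ho' hko
        · exact absurd he' hne
  refine ⟨w₁, w₀, θs, Ms, ?_, ?_, ?_, ?_⟩
  · -- strictly increasing parameters
    intro k k' hkk'
    simp only [hθs]
    exact_mod_cast hτmono (show (k : ℕ) < k' from hkk')
  · -- independence: at each sample all positive items have the same parity
    intro k
    rw [mem_indepSets]
    refine ⟨filter_subset _ _, fun t ht ht1 => ?_⟩
    rw [hMs, mem_filter, mem_Ioc] at ht ht1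
    have hs := ((hsign k t (by omega) (by omega)).1).mp ht.2
    have hs1 := ((hsign k (t + 1) (by omega) (by omega)).1).mp ht1.2
    rcases hs with ⟨_, hot, _⟩ | ⟨_, het, _⟩ <;> rcases hs1 with ⟨_, hot1, _⟩ | ⟨_, het1, _⟩
    · exact (Nat.not_even_iff_odd.mpr hot1) (hot.add_one)
    · omega
    · omega
    · exact (Nat.not_even_iff_odd.mpr (het.add_one)) het1
  · -- unique optimality by the sign certificate
    intro k
    refine unique_of_signs w₁ w₀ (fun t ht => (mem_filter.mp ht).2) ?_
    · intro t ht htM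
      rw [mem_Ioc] at ht
      have hnz := (hsign k t (by omega) (by omega)).2
      have hnp : ¬ 0 < W w₁ w₀ t (θs k) := fun h => htM (mem_filter.mpr ⟨mem_Ioc.mpr ⟨ht.1, ht.2⟩, h⟩)
      exact lt_of_le_of_ne (not_lt.mp hnp) hnz
  · -- consecutive optima differ: an item changes sign between `θ_e` and `θ_{e+1}`
    intro e heq
    have he1 : ((e.castSucc : Fin (n + 1)) : ℕ) = e := rfl
    have he2 : ((e.succ : Fin (n + 1)) : ℕ) = e + 1 := rfl
    have hen : (e : ℕ) + 1 ≤ n := Nat.succ_le_of_lt e.isLt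
    -- the witness item
    set t := if (e : ℕ) < o then 2 * (e : ℕ) + 1 else 2 * ((e : ℕ) + 1 - o) with ht
    have htb : 1 ≤ t ∧ t ≤ n := by simp only [ht]; split_ifs <;> omega
    have key : (0 < W w₁ w₀ t (θs e.castSucc)) ↔ ¬ (0 < W w₁ w₀ t (θs e.succ)) := by
      rw [(hsign e.castSucc t htb.1 htb.2).1, (hsign e.succ t htb.1 htb.2).1, he1, he2]
      simp only [ht]
      by_cases heo : (e : ℕ) < o
      · rw [if_pos heo]
        have hodd : Odd (2 * (e : ℕ) + 1) := ⟨e, rfl⟩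
        have hnev : ¬ Even (2 * (e : ℕ) + 1) := Nat.not_even_iff_odd.mpr hodd
        constructor
        · rintro _ (⟨_, _, h⟩ | ⟨_, hev, _⟩)
          · omega
          · exact hnev hev
        · intro _
          exact Or.inl ⟨heo.le, hodd, le_rfl⟩
      · rw [if_neg heo]
        have hev : Even (2 * ((e : ℕ) + 1 - o)) := ⟨(e : ℕ) + 1 - o, by ring⟩
        have hnodd : ¬ Odd (2 * ((e : ℕ) + 1 - o)) := fun h => (Nat.not_even_iff_odd.mpr h) hev
        constructor
        · rintro (⟨h, _, _⟩ | ⟨_, _, h⟩) _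
          · omega
          · omega
        · intro h
          by_contra h'
          apply h
          exact Or.inr ⟨by omega, hev, le_rfl⟩
    have hmem : t ∈ Ms e.castSucc ↔ t ∈ Ms e.succ := by rw [heq]
    simp only [hMs, mem_filter, mem_Ioc, zero_add] at hmem
    have h1 : 0 < W w₁ w₀ t (θs e.castSucc) ↔ 0 < W w₁ w₀ t (θs e.succ) :=
      ⟨fun h => (hmem.mp ⟨⟨htb.1, htb.2⟩, h⟩).2, fun h => (hmem.mpr ⟨⟨htb.1, htb.2⟩, h⟩).2⟩
    rw [key] at h1
    exact iff_not_self h1.symm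

end

end StaticPathFold

end Summit.ValiantsHypothesis.ValiantsHypothesis.Theorems.KPlusLogSqLaw
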